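import Literature.Topology.FourManifolds.CoupleSaddleRegions

/-!
# Passages through the saddle boxes of a couple: agreement of the cone map, the exit
# transports and the model conjugations

Topic `Literature/Topology/FourManifolds` (seventh file of the *structure conjugacy* of two
one-level Morse data on a handlebody, support of `stmt-SmoothPoincare4-15190`; the two-function
analogue of `PairSaddlePassage.lean` / `PairSaddleRigid.lean`).  Everything here is **proved**;
the one new definition is the rigidity predicate of the direction map.

Milnor, *Lectures on the h-cobordism theorem* (1965), proofs of Thms. 3.12–3.13: near a critical
point two Morse data are compared through the Milnor coordinates, elsewhere along the
trajectories.  For a couple with saddle data `Q`, a level map `M` and a direction map `T` let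

* `SaddleData.TRigid Q T s δ` — **rigidity of `T` at the saddle `s` with width `δ`**: for every
  point `e` of the entrance discs `QA.Uent s δ` at the level `c_A - ε²`, the `B`-direction of
  `MC s e` is `T` of the `A`-direction of `e` (i.e. `T` is the identity in the entrance charts of
  the two saddles `s`, `σ s`).

Then the three pieces of the structure conjugacy agree where they overlap:

* `LT_refExit_eq_MC` — the exit transport of `s` agrees with `MC s` on the `ρ`-ball (`ρ ≤ ε`);
* `coneMap_eq_MC` — under rigidity, the cone map agrees with `MC s` at the basin points of the
  `ρ`-ball (`ρ ≤ ε`, `ρ⁴ / 4ε² < δ`): the backward passage to the entrance discs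
  (`exists_entrance_of_mem_chartBall`) is conjugated by `MC s` (`MC_θ`);
* `coneMap_eq_LT_refExit` — under rigidity, the cone map agrees with the exit transport of `s`
  at the basin points of its domain (exit width `δ' ≤ ε²`, `2δ' ≤ δ`): the backward passage from
  the exit annulus to the entrance discs (`MilnorBox.exists_entrance_level`).

## References

* J. Milnor, *Lectures on the h-cobordism theorem* (1965), Def. 3.1, Def. 3.9, Thm. 4.1, proofs of
  Thms. 3.12–3.13 (PDF pp. 12, 16–22). [MilnorHCobordism1965]
-/

open scoped Manifold ContDiff Topology
open Set Function Filter Metric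

noncomputable section

namespace Literature.Topology.FourManifolds

open Cobordism FourManifolds.Flow

universe u

variable {n : ℕ} {W : Type u} [TopologicalSpace W] [T2Space W] [SecondCountableTopology W]
  [CompactSpace W] [ChartedSpace (EuclideanHalfSpace (n + 1)) W] [IsManifold (𝓡∂ (n + 1)) ∞ W]

namespace BasinCouple

variable {gA gB : W → ℝ} {ξA ξB : Π x : W, TangentSpace (𝓡∂ (n + 1)) x} {C : BasinCouple gA gB ξA ξB}

namespace SaddleData

variable (Q : C.SaddleData)

/-! ### Basin points of the boxes -/

/-- A point of a chart domain of `QA` lies strictly above the chart sphere of `A`, hence is not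
the minimum and has level `> g_A p₀`. [folklore] -/
theorem sph_lt_apply_of_mem_source {s : SaddlePt n gA} {z : W} (hz : z ∈ (Q.QA.DA s).chart.source)
    (hzn : ‖(Q.QA.DA s).coord z‖ ≤ 3 * Q.QA.ε) : C.A.sph < gA z := by
  have h1 := Q.QA.abs_apply_sub_c_le_A s hz hzn
  rw [abs_le] at h1
  have h2 := Q.sph_lt_A
  linarith [h1.1]

/-- A point of the `3ε`-ball of `QA` is not the minimum of `A`. [folklore] -/
theorem ne_p₀_of_mem_chartBall {s : SaddlePt n gA} {z : W} (hz : z ∈ (Q.QA.DA s).chartBall (3 * Q.QA.ε)) :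
    z ≠ C.A.p₀ := fun h => by
  have h1 := Q.sph_lt_apply_of_mem_source hz.1 hz.2.le
  rw [h] at h1
  exact lt_asymm h1 C.A.apply_p₀_lt_sph

/-- A point of the `3ε`-ball of `QA` has level in `(g_A p₀, hi)`. [folklore] -/
theorem apply_mem_Ioo_of_mem_chartBall {s : SaddlePt n gA} {z : W} (hz : z ∈ (Q.QA.DA s).chartBall (3 * Q.QA.ε)) :
    gA z ∈ Ioo (gA C.A.p₀) C.A.hi := by
  have h : gA z ∈ Ioo C.A.sph (1 - C.A.S.a') := Q.QA.apply_mem_Ioo_A s hz.1 hz.2.le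
  exact ⟨C.A.apply_p₀_lt_sph.trans h.1, h.2.trans (C.A.one_sub_a'_lt_L.trans C.A.L_lt_hi)⟩

/-- **A basin point of the `3ε`-ball is off the local unstable disc**: `x⃗ ≠ 0` (for
`|y⃗|² ≤ 4ε²`), since points with `x⃗ = 0` never meet the small sphere level `sphR < c_A`, which
basin points do. [cite: MilnorHCobordism1965, proof of Thm. 3.12 (PDF p. 18)] -/
theorem sqSumLT_pos_of_mem_basin {s : SaddlePt n gA} {z : W} (hz : z ∈ (Q.QA.DA s).chartBall (3 * Q.QA.ε))
    (hb : sqSumGE (Q.QA.DA s).k ((Q.QA.DA s).coord z) ≤ 4 * Q.QA.ε ^ 2) (hzb : z ∈ C.A.basin) :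
    0 < sqSumLT (Q.QA.DA s).k ((Q.QA.DA s).coord z) := by
  refine lt_of_le_of_ne (sqSumLT_nonneg _ _) fun h0 => ?_
  have hhit : Hits C.A.θ gA C.A.sphR z :=
    C.A.hits_sphR_of_mem_basin hzb (Q.ne_p₀_of_mem_chartBall hz) (Q.apply_mem_Ioo_of_mem_chartBall hz).2.le
  exact Q.QA.not_hits_of_sqSumLT_eq_zero hz.1 h0.symm hb (C.A.sphR_lt_sph.trans Q.QA.sph_lt_c) hhit

/-- `MC s` carries points of the `3ε`-ball below `c_A` into the basin of `B`. [folklore] -/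
theorem MC_mem_basin {s : SaddlePt n gA} {z : W} (hz : z ∈ (Q.QA.DA s).chartBall (3 * Q.QA.ε)) (hℓ : gA z < Q.QA.c) :
    Q.MC s z ∈ C.B.basin :=
  Q.QB.mem_basin_of_apply_lt_c (by rw [Q.apply_MC hz.1 hz.2.le]; linarith)

/-- `MC s` carries points of the `3ε`-ball to points other than the minimum of `B`. [folklore] -/
theorem MC_ne_p₀ {s : SaddlePt n gA} {z : W} (hz : z ∈ (Q.QA.DA s).chartBall (3 * Q.QA.ε)) : Q.MC s z ≠ C.B.p₀ :=
  Q.swap.ne_p₀_of_mem_chartBall (by have h := Q.MC_mem_chartBall le_rfl hz; rw [← Q.εB_eq] at h; exact h)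

/-- `MC s` carries points of the `3ε`-ball to levels in `(g_B p₀', hi)`. [folklore] -/
theorem apply_MC_mem_Ioo {s : SaddlePt n gA} {z : W} (hz : z ∈ (Q.QA.DA s).chartBall (3 * Q.QA.ε)) :
    gB (Q.MC s z) ∈ Ioo (gB C.B.p₀) C.B.hi :=
  Q.swap.apply_mem_Ioo_of_mem_chartBall (by have h := Q.MC_mem_chartBall le_rfl hz; rw [← Q.εB_eq] at h; exact h)

variable {Q} (M : Q.LevelMap)

/-- On the `3ε`-ball the level of `MC s z` is `lam (g_A z)`. [folklore] -/
theorem apply_MC_eq_lam {s : SaddlePt n gA} {z : W} (hz : z ∈ (Q.QA.DA s).chartBall (3 * Q.QA.ε)) :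
    gB (Q.MC s z) = M.lam (gA z) := by
  rw [Q.apply_MC hz.1 hz.2.le, M.lam_of_abs_le _ (Q.QA.abs_apply_sub_c_le_A s hz.1 hz.2.le)]

/-! ### Rigidity of the direction map at a saddle -/

variable (Q) in
/-- **Rigidity of the direction map `T` at the saddle `s`, width `δ`**: at the points of the
entrance discs of `s` (width `δ`, level `c_A - ε²`) the `B`-direction of the model conjugate is
`T` of the `A`-direction — `T` is the identity in the entrance charts of `s` and `σ s`. [cite: MilnorHCobordism1965, proof of Thm. 3.13 (PDF pp. 18–19)] -/
def TRigid (T : EuclideanSpace ℝ (Fin (n + 1)) → EuclideanSpace ℝ (Fin (n + 1))) (s : SaddlePt n gA) (δ : ℝ) : Prop :=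
  ∀ e ∈ Q.QA.Uent s δ, gA e = Q.QA.c - Q.QA.ε ^ 2 → C.B.dir (Q.MC s e) = T (C.A.dir e)

variable {T : EuclideanSpace ℝ (Fin (n + 1)) → EuclideanSpace ℝ (Fin (n + 1))}

/-- Rigidity is inherited by smaller widths. [folklore] -/
theorem TRigid.mono {s : SaddlePt n gA} {δ δ' : ℝ} (h : Q.TRigid T s δ) (hle : δ' ≤ δ) : Q.TRigid T s δ' :=
  fun e he heℓ => h e (Q.QA.Uent_mono hle he) heℓ

/-! ### The exit transport and the model conjugation -/

/-- **The exit transport of `s` agrees with `MC s` on the `ρ`-ball** (`ρ ≤ ε`). [cite: MilnorHCobordism1965, proof of Thm. 3.13 (PDF pp. 18–19)] -/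
theorem LT_refExit_eq_MC {s : SaddlePt n gA} {δ ρ : ℝ} (hρ : ρ ≤ Q.QA.ε) {x : W}
    (hxb : x ∈ (Q.QA.DA s).chartBall ρ) (hx₂ : x ∈ (Q.refExit M s δ).dom) : (Q.refExit M s δ).LT x = Q.MC s x := by
  have hx3 : x ∈ (Q.QA.DA s).chartBall (3 * Q.QA.ε) := ⟨hxb.1, by linarith [hxb.2, Q.QA.ε_pos]⟩
  have hb : 0 < sqSumGE (Q.QA.DA s).k ((Q.QA.DA s).coord x) := by
    refine lt_of_le_of_ne (sqSumGE_nonneg _ _) fun h0 => ?_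
    exact Q.QA.not_hits_of_sqSumGE_eq_zero hx3 h0.symm (lt_add_of_pos_right _ Q.QA.sq_pos) hx₂.2.2.1
  obtain ⟨t, ht0, htℓ, -, hpass, -⟩ := Q.QA.exists_exit_of_mem_chartBall hρ hxb hb
  have hMC : Q.MC s (C.A.θ (t, x)) = C.B.θ (t, Q.MC s x) := Q.MC_θ le_rfl ht0 hpass ⟨ht0, le_rfl⟩
  have href : (Q.refExit M s δ).ref x = C.A.θ (t, x) := by
    rw [RefData.ref_def, refExit_ℓ₀]
    exact (BasinPair.diag C.A).levelProj_A_eq_θ hx₂.2.1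
      ⟨Q.QA.apply_p₀_lt_c.trans (lt_add_of_pos_right _ Q.QA.sq_pos), Q.QA.c_add_sq_lt_hi⟩ htℓ
  refine RefData.LT_eq_of_exists_θ hx₂ ⟨-t, ?_⟩ (apply_MC_eq_lam M hx3)
  show C.B.θ (-t, Q.MC s ((Q.refExit M s δ).ref x)) = Q.MC s x
  rw [href, hMC, C.B.θ_add, neg_add_cancel, C.B.θ_zero]

/-! ### The cone map and the model conjugation -/

/-- **Under rigidity the cone map agrees with `MC s` at the basin points of the `ρ`-ball**
(`ρ ≤ ε`, `ρ⁴ / 4ε² < δ`): the backward passage to the entrance discs is conjugated by `MC s`, and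
the `B`-direction there is `T` of the `A`-direction. [cite: MilnorHCobordism1965, proofs of Thms. 3.12–3.13 (PDF pp. 18–19)] -/
theorem coneMap_eq_MC {s : SaddlePt n gA} {δ ρ : ℝ} (hR : Q.TRigid T s δ) (hρ : ρ ≤ Q.QA.ε)
    (hρδ : ρ ^ 4 / (4 * Q.QA.ε ^ 2) < δ) {x : W} (hxb : x ∈ (Q.QA.DA s).chartBall ρ) (hx : x ∈ C.A.basin) :
    C.A.coneMap C.B T M.lam x = Q.MC s x := by
  have hε := Q.QA.ε_pos
  have hx3 : x ∈ (Q.QA.DA s).chartBall (3 * Q.QA.ε) := ⟨hxb.1, by linarith [hxb.2]⟩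
  have hxI := Q.apply_mem_Ioo_of_mem_chartBall hx3
  have hx0 := Q.ne_p₀_of_mem_chartBall hx3
  -- `x` is off the local unstable disc
  have hB4 : sqSumGE (Q.QA.DA s).k ((Q.QA.DA s).coord x) ≤ 4 * Q.QA.ε ^ 2 := by
    have h1 := sqSumLT_add_sqSumGE (Q.QA.DA s).k ((Q.QA.DA s).coord x)
    have h2 : ‖(Q.QA.DA s).coord x‖ ^ 2 ≤ Q.QA.ε ^ 2 :=
      (pow_le_pow_left₀ (norm_nonneg _) hxb.2.le 2).trans (pow_le_pow_left₀ ((norm_nonneg _).trans hxb.2.le) hρ 2)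
    nlinarith [sqSumLT_nonneg (Q.QA.DA s).k ((Q.QA.DA s).coord x)]
  have ha : 0 < sqSumLT (Q.QA.DA s).k ((Q.QA.DA s).coord x) := Q.sqSumLT_pos_of_mem_basin hx3 hB4 hx
  -- the backward passage to the entrance discs
  obtain ⟨t, ht0, htℓ, hB, hpass, -⟩ := Q.QA.exists_entrance_of_mem_chartBall hρ hxb ha
  set e : W := C.A.θ (t, x) with he
  have he3 : e ∈ (Q.QA.DA s).chartBall (3 * Q.QA.ε) := hpass t ⟨le_rfl, ht0⟩
  have heU : e ∈ Q.QA.Uent s δ := ⟨he3, hB.trans_lt hρδ⟩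
  have hMC : Q.MC s e = C.B.θ (t, Q.MC s x) := Q.MC_θ ht0 le_rfl hpass ⟨le_rfl, ht0⟩
  -- directions
  have hxnc : ¬ IsMCriticalPt (𝓡∂ (n + 1)) gA x := C.A.not_isMCriticalPt_of_mem_basin hx hx0 hxI.2.le
  have hdir : C.B.dir (Q.MC s e) = T (C.A.dir x) := by
    rw [hR e heU htℓ, he, C.A.dir_θ hxnc (C.A.hits_sphR_of_mem_basin hx hx0 hxI.2.le)]
  have heℓ : gA e = Q.QA.c - Q.QA.ε ^ 2 := htℓ
  have heℓ' : gA e < Q.QA.c := by rw [heℓ]; exact sub_lt_self _ Q.QA.sq_pos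
  exact coneMap_eq_of_exists_θ (Q.MC_mem_basin he3 heℓ') (Q.MC_ne_p₀ he3) (Q.apply_MC_mem_Ioo he3).2 hdir
    ⟨-t, by rw [hMC, C.B.θ_add, neg_add_cancel, C.B.θ_zero]⟩ (apply_MC_eq_lam M hx3) (M.lam_mem_Ioo_p₀_hi hxI)

/-! ### The cone map and the exit transport -/

/-- **Under rigidity the cone map agrees with the exit transport of `s` at the basin points of
its domain** (exit width `δ' ≤ ε²` with `2δ' ≤ δ`): the exit reference point, off the local
unstable disc, is reached from the entrance discs through the `3ε`-ball. [cite: MilnorHCobordism1965, proofs of Thms. 3.12–3.13 (PDF pp. 18–19)] -/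
theorem coneMap_eq_LT_refExit {s : SaddlePt n gA} {δ δ' : ℝ} (hR : Q.TRigid T s δ) (hδ' : δ' ≤ Q.QA.ε ^ 2)
    (hδδ : 2 * δ' ≤ δ) {x : W} (hx₂ : x ∈ (Q.refExit M s δ').dom) (hx : x ∈ C.A.basin) :
    C.A.coneMap C.B T M.lam x = (Q.refExit M s δ').LT x := by
  have hε := Q.QA.ε_pos
  set D := Q.QA.DA s with hD
  -- the exit reference point `q`
  set q : W := (Q.refExit M s δ').ref x with hq
  have hqU : q ∈ Q.QA.Uexit s δ' := hx₂.2.2.2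
  have hqℓ : gA q = Q.QA.c + Q.QA.ε ^ 2 := RefData.apply_ref hx₂
  have hq3 : q ∈ D.chartBall (3 * Q.QA.ε) := hqU.1
  have hxhi : gA x ≤ C.A.hi := hx₂.1.2.le
  have hqb : q ∈ C.A.basin := by
    rw [hq, RefData.ref_def, levelProj_apply]
    refine (C.A.θ_mem_basin_iff hxhi ?_).2 hx
    show gA q ≤ C.A.hi
    rw [hqℓ]; exact Q.QA.c_add_sq_lt_hi.le
  -- coordinates of `q`: `|x⃗|² = η < δ'`, `|y⃗|² = ε² + η`
  set η : ℝ := sqSumLT D.k (D.coord q) with hη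
  have hηδ : η < δ' := hqU.2
  have hQ : milnorQuadratic D.k (D.coord q) = Q.QA.ε ^ 2 := by
    have h := Q.QA.apply_eq_of_mem_chartBall hq3; rw [hqℓ] at h; linarith
  have hGE : sqSumGE D.k (D.coord q) = Q.QA.ε ^ 2 + η := by rw [milnorQuadratic_eq] at hQ; linarith
  have hη0 : 0 < η := Q.sqSumLT_pos_of_mem_basin hq3 (by rw [hGE]; nlinarith) hqb
  have hηε : η ≤ Q.QA.ε ^ 2 := (hηδ.trans_le hδ').le
  -- the backward passage to the entrance level
  have hprod : sqSumLT D.k (D.coord q) * sqSumGE D.k (D.coord q) / Q.QA.ε ^ 2 ≤ 2 * η := by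
    rw [hGE, div_le_iff₀ (pow_pos hε 2)]; nlinarith
  have hroom : Q.QA.ε ^ 2 + 2 * (sqSumLT D.k (D.coord q) * sqSumGE D.k (D.coord q) / Q.QA.ε ^ 2) < (3 * D.ε) ^ 2 := by
    rw [Q.ε_DA]; nlinarith [pow_pos hε 2]
  obtain ⟨t, ht0, htℓ, hB, hpass⟩ := D.exists_entrance_level C.A.isSmoothFlow_X C.A.contMDiff_X
    (by rw [hD, Q.ε_DA]; exact hq3) hη0 (pow_pos hε 2) (by rw [hQ]; linarith [pow_pos hε 2]) hroom
  set e : W := C.A.θ (t, q) with he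
  have hpass' : ∀ τ ∈ Icc t 0, C.A.θ (τ, q) ∈ D.chartBall (3 * Q.QA.ε) := fun τ hτ => by
    have h := (hpass τ hτ).1; rwa [Q.ε_DA] at h
  have he3 : e ∈ D.chartBall (3 * Q.QA.ε) := hpass' t ⟨le_rfl, ht0⟩
  have heℓ : gA e = Q.QA.c - Q.QA.ε ^ 2 := by rw [he, htℓ, Q.apply_saddle_A]
  have heU : e ∈ Q.QA.Uent s δ := ⟨he3, by linarith [hB.trans hprod]⟩
  have hMC : Q.MC s e = C.B.θ (t, Q.MC s q) := Q.MC_θ ht0 le_rfl hpass' ⟨le_rfl, ht0⟩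
  -- directions: `dir_A e = dir_A q = dir_A x`
  have hxnc : ¬ IsMCriticalPt (𝓡∂ (n + 1)) gA x := hx₂.2.1
  have hx0 : x ≠ C.A.p₀ := fun h => hxnc (h ▸ C.A.isMCriticalPt_p₀)
  have hxs : Hits C.A.θ gA C.A.sphR x := C.A.hits_sphR_of_mem_basin hx hx0 hxhi
  have hqnc : ¬ IsMCriticalPt (𝓡∂ (n + 1)) gA q := C.A.not_isMCriticalPt_levelProj hxnc _
  have hqs : Hits C.A.θ gA C.A.sphR q := by rw [hq, RefData.ref_def, C.A.hits_levelProj_iff]; exact hxs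
  have hdir : C.B.dir (Q.MC s e) = T (C.A.dir x) := by
    rw [hR e heU heℓ, he, C.A.dir_θ hqnc hqs, hq, RefData.ref_def, C.A.dir_levelProj hxnc hxs]
  -- the transported point lies on the `B`-trajectory of `MC s e`
  have heℓ' : gA e < Q.QA.c := by rw [heℓ]; exact sub_lt_self _ Q.QA.sq_pos
  have hy : ∃ τ, C.B.θ (τ, Q.MC s e) = (Q.refExit M s δ').LT x := by
    refine ⟨hittingTime C.B.θ gB (M.lam (gA x)) (Q.MC s q) - t, ?_⟩
    rw [hMC, C.B.θ_add, sub_add_cancel, RefData.LT_def, refExit_Φ, ← hq, levelProj_apply]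
  exact coneMap_eq_of_exists_θ (Q.MC_mem_basin he3 heℓ') (Q.MC_ne_p₀ he3) (Q.apply_MC_mem_Ioo he3).2 hdir hy
    (RefData.apply_LT hx₂) (M.lam_mem_Ioo_p₀_hi ⟨Q.QA.apply_p₀_lt_c.trans hx₂.1.1, hx₂.1.2⟩)

end SaddleData

end BasinCouple

end Literature.Topology.FourManifolds
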